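import Mathlib
import HarnessLib
import Summits.HubbardSuperconductivity.HubbardSuperconductivity.Theorems.KLProgrammeH10TwoPointLimitFrameSectorCell
import Summits.HubbardSuperconductivity.HubbardSuperconductivity.Theorems.KLProgrammeKLRegimeSplitFermiPointLevelC4
import Literature.MathematicalPhysics.QuantumLattice.AnisotropicSectorSupport
import Literature.MathematicalPhysics.QuantumLattice.SectorProductSymbolDecay
import Literature.MathematicalPhysics.QuantumLattice.SectorSymbolMasterZero

/-!
# Route `KLProgramme` — engine support, route (L2) symbol layer: the FRAME BAND `e_K ∘ toLp` (`e_K = ε − μ − K`) as an instance of the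
# generic band hypotheses of `…SymbolCellGeometry` / `…SymbolProductSampled` — `C²` size `4 + 4A`, gradient bound `4 + 2A`, Fermi region
# `‖p‖ ≥ 1`, zone margin, the sector CELL around `klFermiPoint`, and the gradient floor `2ρ_min − 4A` at the frame's Fermi point

Cell `gate-hubbard-kl`, seat p4 (C5a lead), g6; HOME/prover-p4/FRAME-L22-NOTE.md §3″ (d).  For a frame `K` of `C²` size `A`
(`‖Dʲ(frameShift K)‖ ≤ A`, `j ≤ 2`) with `2A < Dt_min` over a band range `B : BandBounds a b` containing `[μ − A − Λ, μ + A + Λ]`: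
* `contDiff_frameBand`, **`norm_iteratedFDeriv_two_frameBand_le`** (`‖D²(e_K∘toLp)‖ ≤ 4 + 4A`), `norm_fderiv_frameBand_le` (`≤ 4 + 2A`),
  `abs_fderiv_frameBand_apply_le`;
* **`one_le_norm_of_frameBand_le`** — the shell `{|e_K| ≤ Λ}` lies in the Fermi region `‖p‖ ≥ 1` (`Λ + A − μ ≤ 3`);
* **`frameBand_zone`** — near the zone boundary, `π − z ≤ |p_j| ≤ π + z` (`z ≤ 1`), the band is large: `Λ < |e_K(p)|` once `Λ + A + z² < −μ`;
* **`frameBand_cell`** — a point of the square-with-margin carrying the shell and a smooth sector `ζ̃_{m,ω}(θ(p)) ≠ 0` is within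
  `ρ = (Λ + s_max Dt_min (3w_m/4))/(Dt_min − 2A)` of `klFermiPoint μ K θ_{m,ω}` in the sup norm (`frame_cell`);
* **`gradient_floor_klFermiPoint`** — `√(g₀² + g₁²) ≥ 2ρ_min − 4A` for `gᵢ = D(e_K∘toLp)(p_F)(eᵢ)`, `p_F = klFermiPoint μ K θ` (the Fermi point is a
  FREE curve point of a shifted level, `B.rho_ge`; `e_K(p_F) = 0` is `frameLevel_klFermiPoint` of `…FrameFermiPoint`).
Everything is proved; no definitions, no named facts. [folklore]
-/

noncomputable section

namespace Summit.HubbardSuperconductivity.HubbardSuperconductivity.Theorems.PerturbedFermiCurve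

set_option linter.dupNamespace false -- summit = problem name (single-conjunct summit), D-0017

open Real Set
open Literature.MathematicalPhysics.QuantumLattice Literature.MathematicalPhysics.QuantumLattice.BandSectorCounting
open Literature.Probability.LatticeModels
open Summit.HubbardSuperconductivity.HubbardSuperconductivity.Theorems.DispersionFlow
open Summit.HubbardSuperconductivity.HubbardSuperconductivity.Theorems.KLRegimeSplit

/-! ### §1 Smoothness and derivative sizes of the frame band on `Fin 2 → ℝ` -/

/-- The frame band on `Fin 2 → ℝ` is `ε₀ + δ_K − μ`. -/
theorem frameBand_eq (μ : ℝ) (K : TrigPolyC4v) :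
    (fun p : Fin 2 → ℝ => frameLevel μ K (WithLp.toLp 2 p)) =
      fun p => (sqDispersion p + frameShift K (WithLp.toLp 2 p)) + (-μ) := by
  funext p; rw [frameLevel_toLp]; ring

/-- **The frame band is smooth.** -/
theorem contDiff_frameBand (μ : ℝ) (K : TrigPolyC4v) {m : WithTop ℕ∞} :
    ContDiff ℝ m (fun p : Fin 2 → ℝ => frameLevel μ K (WithLp.toLp 2 p)) := by
  rw [frameBand_eq]
  exact (contDiff_sqDispersion.add (contDiff_frameShift_toLp K)).add contDiff_const

/-- **`C²` size of the frame band**: `‖D²(e_K ∘ toLp)(p)‖ ≤ 4 + 4A`. -/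
theorem norm_iteratedFDeriv_two_frameBand_le {K : TrigPolyC4v} {A : ℝ}
    (hA : ∀ p : Momentum, ∀ j ≤ 2, ‖iteratedFDeriv ℝ j (frameShift K) p‖ ≤ A) (μ : ℝ) (p : Fin 2 → ℝ) :
    ‖iteratedFDeriv ℝ 2 (fun p : Fin 2 → ℝ => frameLevel μ K (WithLp.toLp 2 p)) p‖ ≤ 4 + 4 * A := by
  rw [frameBand_eq]
  have h1 : ContDiff ℝ 2 sqDispersion := contDiff_sqDispersion
  have h2 : ContDiff ℝ 2 (fun k : Fin 2 → ℝ => frameShift K (WithLp.toLp 2 k)) := contDiff_frameShift_toLp K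
  have hsum : iteratedFDeriv ℝ 2 (fun p => (sqDispersion p + frameShift K (WithLp.toLp 2 p)) + (-μ)) p =
      iteratedFDeriv ℝ 2 sqDispersion p + iteratedFDeriv ℝ 2 (fun k : Fin 2 → ℝ => frameShift K (WithLp.toLp 2 k)) p := by
    rw [fun_iteratedFDeriv_add_apply (f := fun p : Fin 2 → ℝ => sqDispersion p + frameShift K (WithLp.toLp 2 p))
      (g := fun _ : Fin 2 → ℝ => (-μ)) ((h1.add h2).contDiffAt) contDiffAt_const,
      iteratedFDeriv_const_of_ne (by norm_num) (-μ), Pi.zero_apply, add_zero,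
      fun_iteratedFDeriv_add_apply (f := sqDispersion) (g := fun k : Fin 2 → ℝ => frameShift K (WithLp.toLp 2 k))
        h1.contDiffAt h2.contDiffAt]
  rw [hsum]
  calc _ ≤ ‖iteratedFDeriv ℝ 2 sqDispersion p‖ + ‖iteratedFDeriv ℝ 2 (fun k : Fin 2 → ℝ => frameShift K (WithLp.toLp 2 k)) p‖ :=
        norm_add_le _ _
    _ ≤ 4 + A * 2 ^ 2 := add_le_add (norm_iteratedFDeriv_sqDispersion_le 2 p) (norm_iteratedFDeriv_frameShift_toLp_le hA p le_rfl)
    _ = 4 + 4 * A := by ring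

/-- **Gradient size of the frame band**: `‖D(e_K ∘ toLp)(p)‖ ≤ 4 + 2A`. -/
theorem norm_fderiv_frameBand_le {K : TrigPolyC4v} {A : ℝ}
    (hA : ∀ p : Momentum, ∀ j ≤ 2, ‖iteratedFDeriv ℝ j (frameShift K) p‖ ≤ A) (μ : ℝ) (p : Fin 2 → ℝ) :
    ‖fderiv ℝ (fun p : Fin 2 → ℝ => frameLevel μ K (WithLp.toLp 2 p)) p‖ ≤ 4 + 2 * A := by
  rw [frameBand_eq]
  have h1 : Differentiable ℝ sqDispersion := contDiff_sqDispersion.differentiable (by norm_num : (1 : WithTop ℕ∞) ≠ 0)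
  have h2 := differentiable_frameShift_toLp K
  have e1 : (fun p => (sqDispersion p + frameShift K (WithLp.toLp 2 p)) + (-μ)) =
      fun p => sqDispersion p + frameShift K (WithLp.toLp 2 p) + (-μ) := rfl
  rw [e1, fderiv_add_const, fderiv_fun_add (h1 p) (h2 p)]
  have hs : ‖fderiv ℝ sqDispersion p‖ ≤ 4 := by
    have := norm_iteratedFDeriv_sqDispersion_le 1 p
    rwa [norm_iteratedFDeriv_one] at this
  exact (norm_add_le _ _).trans (by linarith [norm_fderiv_frameShift_toLp_le hA p])

/-- `|D(e_K ∘ toLp)(p)·w| ≤ (4 + 2A)‖w‖`. -/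
theorem abs_fderiv_frameBand_apply_le {K : TrigPolyC4v} {A : ℝ}
    (hA : ∀ p : Momentum, ∀ j ≤ 2, ‖iteratedFDeriv ℝ j (frameShift K) p‖ ≤ A) (μ : ℝ) (p w : Fin 2 → ℝ) :
    |fderiv ℝ (fun p : Fin 2 → ℝ => frameLevel μ K (WithLp.toLp 2 p)) p w| ≤ (4 + 2 * A) * ‖w‖ := by
  rw [← Real.norm_eq_abs]
  exact ((fderiv ℝ (fun p : Fin 2 → ℝ => frameLevel μ K (WithLp.toLp 2 p)) p).le_opNorm w).trans
    (mul_le_mul_of_nonneg_right (norm_fderiv_frameBand_le hA μ p) (norm_nonneg _))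

/-! ### §2 The Fermi region and the zone margin -/

/-- **The shell lies in the Fermi region**: if `Λ + A − μ ≤ 3` then `|e_K(p)| ≤ Λ ⇒ 1 ≤ ‖k₁ + ik₂‖` (near the origin the band is
`≤ −4 + ‖p‖² + A − μ < −Λ`). -/
theorem one_le_norm_of_frameBand_le {K : TrigPolyC4v} {A : ℝ}
    (hA : ∀ p : Momentum, ∀ j ≤ 2, ‖iteratedFDeriv ℝ j (frameShift K) p‖ ≤ A) {μ Λ : ℝ} (h3 : Λ + A - μ ≤ 3)
    {p : Fin 2 → ℝ} (hp : |frameLevel μ K (WithLp.toLp 2 p)| ≤ Λ) : 1 ≤ ‖momToComplex p‖ := by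
  by_contra hlt
  push Not at hlt
  have hn : ‖momToComplex p‖ ^ 2 < 1 := by
    have := pow_lt_pow_left₀ hlt (norm_nonneg _) two_ne_zero
    simpa using this
  have hε := sqDispersion_le_norm_sq p
  have hδ := abs_le.1 (abs_frameShift_toLp_le hA p)
  have hle := (abs_le.1 hp).1
  rw [frameLevel_toLp] at hle
  linarith

/-- `cos t ≤ −cos z` for `π − z ≤ |t| ≤ π + z`, `0 ≤ z ≤ π`. [folklore] -/
theorem cos_le_neg_cos_of_near_pi {t z : ℝ} (hzπ : z ≤ π) (h1 : π - z ≤ |t|) (h2 : |t| ≤ π + z) :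
    Real.cos t ≤ -Real.cos z := by
  rw [← Real.cos_abs t, ← Real.cos_pi_sub]
  rcases le_or_gt |t| π with hle | hgt
  · -- `π − z ≤ |t| ≤ π`: `cos` is antitone on `[0, π]`
    exact Real.cos_le_cos_of_nonneg_of_le_pi (by linarith) hle h1
  · -- `π < |t| ≤ π + z`: `cos |t| = cos (2π − |t|)` with `π − z ≤ 2π − |t| < π`
    have e : Real.cos |t| = Real.cos (2 * π - |t|) := by rw [Real.cos_two_pi_sub]
    rw [e]
    exact Real.cos_le_cos_of_nonneg_of_le_pi (by linarith) (by linarith) (by linarith)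

/-- **Zone margin**: near the zone boundary (`π − z ≤ |p_j| ≤ π + z` for some `j`, `0 ≤ z ≤ 1`) the frame band exceeds `Λ` once
`Λ + A + z² < −μ` (`ε₀ ≥ −z² `there). -/
theorem frameBand_zone {K : TrigPolyC4v} {A : ℝ}
    (hA : ∀ p : Momentum, ∀ j ≤ 2, ‖iteratedFDeriv ℝ j (frameShift K) p‖ ≤ A) {μ Λ z : ℝ} (hz1 : z ≤ 1)
    (hgap : Λ + A + z ^ 2 < -μ) {p : Fin 2 → ℝ} {j : Fin 2} (h1 : π - z ≤ |p j|) (h2 : |p j| ≤ π + z) :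
    Λ < |frameLevel μ K (WithLp.toLp 2 p)| := by
  have hzπ : z ≤ π := hz1.trans (by linarith [Real.pi_gt_three])
  have hcos : Real.cos (p j) ≤ -Real.cos z := cos_le_neg_cos_of_near_pi hzπ h1 h2
  have hcz : 1 - z ^ 2 / 2 ≤ Real.cos z := Real.one_sub_sq_div_two_le_cos
  have hε : -z ^ 2 ≤ sqDispersion p := by
    rw [sqDispersion]
    have hother : ∀ i, Real.cos (p i) ≤ 1 := fun i => Real.cos_le_one _
    fin_cases j
    · have := hother 1; simp only [Fin.zero_eta, Fin.isValue] at hcos; nlinarith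
    · have := hother 0; simp only [Fin.mk_one, Fin.isValue] at hcos; nlinarith
  have hδ := abs_le.1 (abs_frameShift_toLp_le hA p)
  rw [frameLevel_toLp]
  refine lt_of_lt_of_le ?_ (le_abs_self _)
  linarith

/-! ### §3 The sector cell around the frame's Fermi point -/

section Cell

variable {a b : ℝ} (B : BandBounds a b) {K : TrigPolyC4v} {A : ℝ}
  (hA : ∀ p : Momentum, ∀ j ≤ 2, ‖iteratedFDeriv ℝ j (frameShift K) p‖ ≤ A) (hADt : 2 * A < B.Dtmin) {μ : ℝ}
include B hA hADt

/-- **The sector cell on a frame, sup-norm form**: a point `p` with `|p_i| ≤ π + z`, in the shell `|e_K(p)| ≤ Λ`, carrying the smooth sector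
`ζ̃_{m,ω}(θ(p)) ≠ 0`, lies within `ρ = (Λ + s_max Dt_min (3 w_m/4))/(Dt_min − 2A)` of `klFermiPoint μ K θ_{m,ω}` in the sup norm — provided the
zone margin (`Λ + A + z² < −μ`, `0 ≤ z ≤ 1`) and `[μ − A − Λ, μ + A + Λ] ⊆ [a, b]`. [cite: BenfattoGiulianiMastropietro2006, §2.7 (2.69)] -/
theorem frameBand_cell {Λ z : ℝ} (hz0 : 0 ≤ z) (hz1 : z ≤ 1) (hgap : Λ + A + z ^ 2 < -μ) (hlo : a ≤ μ - A - Λ) (hhi : μ + A + Λ ≤ b)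
    (m ω : ℕ) {p : Fin 2 → ℝ} (hsq : ∀ i, |p i| ≤ π + z) (hshell : |frameLevel μ K (WithLp.toLp 2 p)| ≤ Λ)
    (hζ : sectorWeightCirc m (ω : ℤ) (polarAngle p) ≠ 0) :
    ‖p - klFermiPoint μ K (sectorCenter m ω)‖ ≤ (Λ + B.smax * B.Dtmin * (3 * sectorWidth m / 4)) / (B.Dtmin - 2 * A) := by
  -- the point is inside the closed square (zone margin)
  have hπ : ∀ i, |p i| ≤ π := by
    intro i
    by_contra hgt
    push Not at hgt
    have h1 : π - z ≤ |p i| := by linarith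
    exact absurd hshell (not_le.2 (frameBand_zone hA hz1 hgap h1 (hsq i)))
  -- the angle
  rw [polarAngle, RelativeSectorCount.momToComplex_eq_mk] at hζ
  obtain ⟨kz, hkz⟩ := exists_abs_lt_of_sectorWeightCirc_ne_zero hζ
  have hang : |Complex.arg (⟨p 0, p 1⟩ : ℂ) + (-kz : ℤ) * (2 * π) - sectorCenter m ω| ≤ 3 * sectorWidth m / 4 := by
    rw [sectorCenter]
    have e : Complex.arg (⟨p 0, p 1⟩ : ℂ) + ((-kz : ℤ) : ℝ) * (2 * π) - ((ω : ℝ) + 1 / 2) * sectorWidth m =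
        Complex.arg (⟨p 0, p 1⟩ : ℂ) - ((((ω : ℕ) : ℤ) : ℝ) + 1 / 2) * sectorWidth m - 2 * π * kz := by push_cast; ring
    rw [e]; exact hkz.le
  rw [pi_norm_le_iff_of_nonneg (by
    have := B.smax_pos; have := B.Dtmin_pos; have := sectorWidth_pos m
    have hΛ : 0 ≤ Λ := (abs_nonneg _).trans hshell
    have : 0 < B.Dtmin - 2 * A := by linarith
    positivity)]
  intro i
  rw [Pi.sub_apply, Real.norm_eq_abs]
  exact frame_cell B hA hADt hπ hshell hlo hhi hang i

end Cell

/-! ### §4 The gradient floor at the frame's Fermi point -/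

section Gradient

variable {a b : ℝ} (B : BandBounds a b) {K : TrigPolyC4v} {A : ℝ}
  (hA : ∀ p : Momentum, ∀ j ≤ 2, ‖iteratedFDeriv ℝ j (frameShift K) p‖ ≤ A) {μ : ℝ} (hlo : a ≤ μ - A) (hhi : μ + A ≤ b)
include B hA hlo hhi

/-- **The frame's Fermi point is a FREE curve point of a shifted level**: `klFermiPoint μ K θ = (bandX μ′ θ, bandY μ′ θ)` with
`μ′ = μ − δ_K(p_F) ∈ [a, b]`. -/
theorem klFermiPoint_eq_band (θ : ℝ) :
    ∃ μ' ∈ Icc a b, klFermiPoint μ K θ 0 = bandX μ' θ ∧ klFermiPoint μ K θ 1 = bandY μ' θ := by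
  have hδ : ∀ k : Fin 2 → ℝ, (∀ i, |k i| ≤ π) → |(fun k : Fin 2 → ℝ => frameShift K (WithLp.toLp 2 k)) k| ≤ A :=
    fun k _ => abs_frameShift_toLp_le hA k
  have ht := isBandFermiRadius_perturbedFermiRadius_frame B hA hlo hhi θ
  set t := perturbedFermiRadius (fun k : Fin 2 → ℝ => frameShift K (WithLp.toLp 2 k)) μ θ with htdef
  refine ⟨μ - (fun k : Fin 2 → ℝ => frameShift K (WithLp.toLp 2 k)) (t • dir θ), shiftedLevel_mem_Icc ht hδ hlo hhi, ?_, ?_⟩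
  · rw [klFermiPoint_eq, ← htdef, bandX, ← eq_bandFermiRadius_of_shifted B hδ hlo hhi ht]
    simp [dir]
  · rw [klFermiPoint_eq, ← htdef, bandY, ← eq_bandFermiRadius_of_shifted B hδ hlo hhi ht]
    simp [dir]

/-- **Gradient floor at the frame's Fermi point**: with `gᵢ = D(e_K ∘ toLp)(p_F)(eᵢ)`, `√(g₀² + g₁²) ≥ 2ρ_min − 4A`
(free gradient `(2 sin p₀, 2 sin p₁)` of length `≥ 2ρ_min` by `B.rho_ge` at the shifted level, frame part `≤ 2A` per component). -/
theorem gradient_floor_klFermiPoint (θ : ℝ) :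
    2 * B.rhomin - 4 * A ≤ Real.sqrt
      (fderiv ℝ (fun p : Fin 2 → ℝ => frameLevel μ K (WithLp.toLp 2 p)) (klFermiPoint μ K θ) (Pi.single 0 1) ^ 2 +
        fderiv ℝ (fun p : Fin 2 → ℝ => frameLevel μ K (WithLp.toLp 2 p)) (klFermiPoint μ K θ) (Pi.single 1 1) ^ 2) := by
  set pF := klFermiPoint μ K θ with hpF
  set δK : (Fin 2 → ℝ) → ℝ := fun k => frameShift K (WithLp.toLp 2 k) with hδK
  have h1 : Differentiable ℝ sqDispersion := contDiff_sqDispersion.differentiable (by norm_num : (1 : WithTop ℕ∞) ≠ 0)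
  have h2 : Differentiable ℝ δK := differentiable_frameShift_toLp K
  -- the gradient pair = free part + frame part
  have hgrad : ∀ i : Fin 2, fderiv ℝ (fun p : Fin 2 → ℝ => frameLevel μ K (WithLp.toLp 2 p)) pF (Pi.single i 1) =
      2 * Real.sin (pF i) + fderiv ℝ δK pF (Pi.single i 1) := by
    intro i
    rw [frameBand_eq]
    have e1 : (fun p => (sqDispersion p + frameShift K (WithLp.toLp 2 p)) + (-μ)) = fun p => sqDispersion p + δK p + (-μ) := rfl
    rw [e1, fderiv_add_const, fderiv_fun_add (h1 pF) (h2 pF), add_apply, fderiv_sqDispersion_apply]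
    have hs : 2 * Real.sin (pF 0) * (Pi.single i (1 : ℝ) : Fin 2 → ℝ) 0 + 2 * Real.sin (pF 1) * (Pi.single i (1 : ℝ) : Fin 2 → ℝ) 1 =
        2 * Real.sin (pF i) := by
      fin_cases i
      · simp
      · simp
    rw [hs]
  -- sizes
  have hd : ∀ i : Fin 2, |fderiv ℝ δK pF (Pi.single i 1)| ≤ 2 * A := by
    intro i
    rw [← Real.norm_eq_abs]
    refine ((fderiv ℝ δK pF).le_opNorm _).trans ?_
    have hn : ‖(Pi.single i (1 : ℝ) : Fin 2 → ℝ)‖ = 1 := by rw [Pi.norm_single, norm_one]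
    rw [hn, mul_one]
    exact norm_fderiv_frameShift_toLp_le hA pF
  obtain ⟨μ', hμ', hx, hy⟩ := klFermiPoint_eq_band B hA hlo hhi θ
  have hrho := B.rho_ge μ' hμ' θ
  rw [← hx, ← hy, ← hpF] at hrho
  -- Minkowski in the plane via `momToComplex`
  set s : Fin 2 → ℝ := fun i => 2 * Real.sin (pF i) with hs
  set d : Fin 2 → ℝ := fun i => fderiv ℝ δK pF (Pi.single i 1) with hdd
  have hnorm : ∀ v : Fin 2 → ℝ, Real.sqrt (v 0 ^ 2 + v 1 ^ 2) = ‖momToComplex v‖ := fun v => by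
    rw [← norm_momToComplex_sq, Real.sqrt_sq (norm_nonneg _)]
  have hG : Real.sqrt
      (fderiv ℝ (fun p : Fin 2 → ℝ => frameLevel μ K (WithLp.toLp 2 p)) pF (Pi.single 0 1) ^ 2 +
        fderiv ℝ (fun p : Fin 2 → ℝ => frameLevel μ K (WithLp.toLp 2 p)) pF (Pi.single 1 1) ^ 2) =
      ‖momToComplex s + momToComplex d‖ := by
    rw [hgrad 0, hgrad 1]
    have hadd : momToComplex (s + d) = momToComplex s + momToComplex d := by
      have := momToComplex_add_smul s d 1; simpa using this
    rw [← hadd, ← hnorm (s + d)]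
    rfl
  rw [hG]
  -- the free part has length `≥ 2ρ_min`, the frame part `≤ 4A`
  have hsn : 2 * B.rhomin ≤ ‖momToComplex s‖ := by
    rw [← hnorm s]
    have e : s 0 ^ 2 + s 1 ^ 2 = 2 ^ 2 * (Real.sin (pF 0) ^ 2 + Real.sin (pF 1) ^ 2) := by simp only [hs]; ring
    rw [e, Real.sqrt_mul (by norm_num), Real.sqrt_sq (by norm_num)]
    linarith [mul_le_mul_of_nonneg_left hrho (by norm_num : (0 : ℝ) ≤ 2)]
  have hdn : ‖momToComplex d‖ ≤ 4 * A := by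
    refine (norm_momToComplex_le d).trans ?_
    have h0 := hd 0; have h1 := hd 1
    simp only [hdd] at h0 h1 ⊢
    linarith
  have htri : ‖momToComplex s‖ - ‖momToComplex d‖ ≤ ‖momToComplex s + momToComplex d‖ := by
    have := norm_sub_le (momToComplex s + momToComplex d) (momToComplex d)
    rw [add_sub_cancel_right] at this
    linarith
  linarith

end Gradient

end Summit.HubbardSuperconductivity.HubbardSuperconductivity.Theorems.PerturbedFermiCurve

end
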